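import Literature.Probability.Process.MatrixRenewalCoefficients
import Literature.Analysis.Matrix.NonnegMatrixFamilyResidue
import Mathlib.Analysis.Normed.Group.Tannery
import HarnessLib

/-!
# The constant of the matrix renewal theorem: the Abelian limit of a critical matrix renewal pair is the rank-one matrix
# `u ℓᵀ/⟨ℓ, μ u⟩` — fixed-vector-free, `L_{ab} · (Σ_{c,d} L_{oc} μ_{cd} L_{do}) = L_{ao} L_{ob}` (module «MATRIX-RENEWAL-CONSTANT»)

Topic `Literature/Probability/Process` (renewal theory; continues `MatrixRenewalCoefficients.lean` — the matrix renewal pair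
`RenewalKernelPair` (`D(m) = M(m) + Σ_{i+j=m} M(i) D(j)`, non-negative `ι × ι` matrices on a finite level set), its power-series bookkeeping
(`serM`, `serG`, `cf`, `G_eq_tsum : 1 + D = Σ_k I^k` coefficientwise, the positivity semigroup `Pos`), the critical regime `Critical L`
(Abelian limits `(1 − s) Σ_m D(m)_{ab} s^m → L_{ab} > 0`, finite first moment `Σ_j j M(j)_{ab} < ∞`, aperiodicity) and THE THEOREM
`RenewalKernelPair.tendsto_coeff : D(m)_{ab} → L_{ab}`; tool: the tree's spectral-theory-free uniqueness of positive fixed vectors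
`Literature.Analysis.Matrix.exists_eq_smul_of_mulVec_eq` / `…_of_vecMul_eq` (`NonnegMatrixFamilyResidue.lean` §B) and Mathlib's Tannery theorem).
Lane «pcv-sawmu» (CriticalPhenomena venture), a-p2 g23 — the abstract form of «AMPLITUDE-RATIO» (`RandomPlanarGeometry/HexSAWStripAmplitudeRatio.lean`,
where the same identities are proved for the two gradings of the honeycomb-strip bridge kernel).

THE POINT.  `tendsto_coeff` proves convergence to the Abelian limit `L`, which enters as DATA characterised only by
`(1 − s) Σ_m D(m) s^m → L`; on the diagonal the tree adds `L_{ee} = 1/Σ_m m φ_e(m)` (mean first-RETURN length).  Here `L` is identified in terms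
of the ONE-PIECE kernel alone: with the total-mass matrix `M̂ = Σ_j M(j)` and the first-moment matrix `μ = Σ_j j M(j)`,
(i) `M̂ L = L = L M̂` (columns / rows of `L` are right / left fixed vectors of `M̂`); (ii) `L` has RANK ONE (`L_{ab}L_{cd} = L_{ad}L_{cb}`);
(iii) the SCALE: `Σ_{c,d} L_{oc} μ_{cd} L_{db} = L_{ob}`; hence (iv) `L_{ab} · (Σ_{c,d} L_{oc} μ_{cd} L_{do}) = L_{ao} L_{ob}` for every reference level `o`,
i.e. `L = u ℓᵀ/⟨ℓ, μ u⟩` for ANY right/left fixed vectors `u, ℓ` of `M̂` — the classical constant of the Markov renewal theorem («stationary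
weight of the embedded chain over the mean sojourn»), the matrix form of Feller's `u_n → 1/μ`.

THE PROOF (no spectral theory, no Perron–Frobenius).  §1 `M̂` is finite (finite first moment), `I(s) = Σ_j M(j)s^j → M̂` and
`(M̂ − I(s))/(1 − s) → μ` as `s ↑ 1` (dominated convergence).  §2 the renewal equation for the generating functions on `[0,1)` in BOTH orders —
the right-sided coefficient equation `D(m) = M(m) + Σ D(i)M(j)` (`ren_right`) is read off `1 + D = Σ_k I^k`.  §3 multiply by `1 − s` and let
`s ↑ 1`: `M̂ L = L`, `L M̂ = L`; multiply the left equation by the row `L_{o·}` (left fixed), use `L_{o·}(1 − I(s)) = L_{o·}(M̂ − I(s))`, divide by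
`1 − s`: `Σ_{c,d} L_{oc} μ_{cd} L_{db} = L_{ob}`.  §4 `M̂ ≥ 0` is irreducible (`L > 0` through the tree's positivity semigroup, and `[s^m]I^k ≤ M̂^k`),
so by the minimum-ratio lemma every column of `L` is a multiple of a fixed positive column: rank one.  §5 assemble.

Sources of the TEMPLATE: E. Çinlar, *Markov renewal theory*, Adv. Appl. Probab. 1 (1969) 123–187 (the Markov renewal theorem for a finite
state space and the form of its limit; NOT held by the lane — locator carried); W. Feller I (1968) XIII.3, XIII.11 (`u_n → 1/μ`, delayed
renewal); E. Seneta (1973) §1.4 (uniqueness of the positive eigenvector), §6.2 Theorems 6.3–6.4 (R-positivity: positive left/right vectors,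
finite derivative at the convergence parameter).  The arrangement through the two-sided renewal equations and the endpoint slope, with the Abelian
limit as the only analytic input, is the lane's.

## What is proved (namespace `Literature.Probability.Process.RenewalKernelPair`; `K : RenewalKernelPair ι`, `h : K.Critical L`; `M̂`, `μ` are written
## out as `Matrix.of fun a b => ∑' j, K.M j a b` and `… ∑' j, (j : ℝ) * K.M j a b` — no new definitions)

* §1 `Critical.summable_M` (`Σ_j M(j)_{ab} < ∞`), `Critical.summable_genM`, ★ `Critical.tendsto_genM` (`I(s) → M̂`), ★ `Critical.tendsto_slope_genM`
  (`(M̂ − I(s))/(1 − s) → μ`).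
* §2 ★ `Critical.genD_eq_genM_add_sum` (`D(s) = I(s) + I(s)D(s)` on `[0,1)`), ★ `ren_right` (`D(m) = M(m) + Σ_{i+j=m} D(i) M(j)`, every pair),
  ★ `Critical.genD_eq_genM_add_sum'` (`D(s) = I(s) + D(s)I(s)`).
* §3 ★★ `Critical.tsum_M_mul_L` (`M̂ L = L`), ★★ `Critical.L_mul_tsum_M` (`L M̂ = L`), ★★ `Critical.sum_L_mean_L` (`Σ_{c,d} L_{oc} μ_{cd} L_{db} = L_{ob}`).
* §4 `Critical.cf_pow_le_pow_tsum` (`[s^m]I^k ≤ M̂^k`), ★ `Critical.tsum_M_nonneg_irred`, ★★ `Critical.L_mul_L_eq` (rank one: `L_{ab}L_{cd} = L_{ad}L_{cb}`).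
* §5 ★★★ `Critical.L_mul_sum_mean_eq` — `L_{ab} · (Σ_{c,d} L_{oc} μ_{cd} L_{do}) = L_{ao} L_{ob}`; ★★★ `Critical.L_mul_dotProduct_mean_eq` — for ANY right
  fixed `u` and left fixed `ℓ` of `M̂` (any sign): `L_{ab} · ⟨ℓ, μ u⟩ = u_a ℓ_b`; ★★ `Critical.exists_pos_fixed` (columns / rows of `L` are positive fixed
  vectors, the mean pairing through `o` is `L_{oo} > 0`); ★★★ `Critical.tendsto_coeff_const` — `D(m)_{ab} → L_{ao}L_{ob}/(Σ_{c,d} L_{oc} μ_{cd} L_{do})`.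

Label: CLASSICAL THEOREM (the constant of the Markov renewal theorem) in the lane's ARRANGEMENT (own proof route, a-p2 g23, 2026-08-27); it
completes the tree's `tendsto_coeff` by identifying its limit.  NOT claimed: the periodic and null-recurrent cases, infinite `ι`, rates,
positivity of `μ` entrywise, anything with `L` not assumed through the Abelian hypothesis of `Critical`.
-/

noncomputable section

open Finset Filter Topology Matrix PowerSeries Literature.Analysis.Matrix

namespace Literature.Probability.Process

namespace RenewalKernelPair

variable {ι : Type*} [Fintype ι] [DecidableEq ι] {K : RenewalKernelPair ι} {L : ι → ι → ℝ}

/-! ### §1 The one-piece kernel at and near `s = 1`: total mass, generating function, endpoint slope -/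

section Kernel

/-- Under criticality the one-piece kernel has finite total mass: `Σ_j M(j)_{ab} < ∞` (from the finite first moment, `M(j) ≤ j M(j)` for
`j ≥ 1`). [cite: Feller1968, XIII.3–4; Cinlar1969MarkovRenewal, Markov renewal theory, finite state space (locator carried — not held); lane plumbing a-p2 g23] -/
theorem Critical.summable_M (h : K.Critical L) (a b : ι) : Summable fun j : ℕ => K.M j a b := by
  have hm := h.mean a b
  refine (((hm.add (summable_of_ne_finset_zero (s := {0}) (f := fun j : ℕ => if j = 0 then K.M 0 a b else 0)
    (fun j hj => by rw [mem_singleton] at hj; simp [hj])))).of_nonneg_of_le (fun j => K.M_nonneg j a b) fun j => ?_)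
  by_cases hj : j = 0
  · subst hj; simp
  · have h1 : (1 : ℝ) ≤ j := by exact_mod_cast Nat.one_le_iff_ne_zero.2 hj
    have := K.M_nonneg j a b
    simp only [hj, if_false, add_zero]
    nlinarith

/-- The generating function of the one-piece kernel converges on `[0,1]` and tends to the total mass as `s ↑ 1`:
`Σ_j M(j)_{ab} s^j → Σ_j M(j)_{ab}`. [cite: Feller1968, XIII.3–4; Cinlar1969MarkovRenewal, Markov renewal theory, finite state space (locator carried — not held); lane plumbing a-p2 g23] -/
theorem Critical.tendsto_genM (h : K.Critical L) (a b : ι) :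
    Tendsto (fun s : ℝ => ∑' j : ℕ, K.M j a b * s ^ j) (𝓝[<] 1) (𝓝 (∑' j : ℕ, K.M j a b)) := by
  have hM0 := fun j => K.M_nonneg j a b
  exact tendsto_tsum_of_dominated_convergence (𝓕 := 𝓝[<] (1 : ℝ)) (f := fun (s : ℝ) (j : ℕ) => K.M j a b * s ^ j)
    (g := fun j : ℕ => K.M j a b) (bound := fun j : ℕ => K.M j a b) (h.summable_M a b)
    (fun j => by
      have : Tendsto (fun s : ℝ => K.M j a b * s ^ j) (𝓝 1) (𝓝 (K.M j a b * 1 ^ j)) := ((continuous_pow j).tendsto 1).const_mul _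
      rw [one_pow, mul_one] at this
      exact this.mono_left nhdsWithin_le_nhds)
    (by
      filter_upwards [Ico_mem_nhdsLT zero_lt_one] with s hs j
      rw [Real.norm_eq_abs, abs_of_nonneg (mul_nonneg (hM0 j) (pow_nonneg hs.1 _))]
      exact mul_le_of_le_one_right (hM0 j) (pow_le_one₀ hs.1 hs.2.le))

/-- Summability of the generating function of the one-piece kernel on `[0,1]`. [cite: Feller1968, XIII.3–4; lane plumbing a-p2 g23] -/
theorem Critical.summable_genM (h : K.Critical L) (a b : ι) {s : ℝ} (hs0 : 0 ≤ s) (hs1 : s ≤ 1) :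
    Summable fun j : ℕ => K.M j a b * s ^ j :=
  (h.summable_M a b).of_nonneg_of_le (fun j => mul_nonneg (K.M_nonneg j a b) (pow_nonneg hs0 _))
    fun j => mul_le_of_le_one_right (K.M_nonneg j a b) (pow_le_one₀ hs0 hs1)

/-- ★ **The endpoint slope of the one-piece generating function is the first-moment matrix**:
`(Σ_j M(j)_{ab} − Σ_j M(j)_{ab} s^j)/(1 − s) → Σ_j j M(j)_{ab}` as `s ↑ 1` (dominated convergence of `(1 − s^j)/(1 − s) ↑ j` on the finite
first moment). [cite: Feller1968, XIII.11 (the mean recurrence time); Cinlar1969MarkovRenewal, Markov renewal theory, finite state space (locator carried — not held); lane plumbing a-p2 g23] -/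
theorem Critical.tendsto_slope_genM (h : K.Critical L) (a b : ι) :
    Tendsto (fun s : ℝ => ((∑' j : ℕ, K.M j a b) - ∑' j : ℕ, K.M j a b * s ^ j) / (1 - s)) (𝓝[<] 1)
      (𝓝 (∑' j : ℕ, (j : ℝ) * K.M j a b)) := by
  set M : ℕ → ℝ := fun j => K.M j a b with hM
  have hM0 : ∀ j, 0 ≤ M j := fun j => K.M_nonneg j a b
  have hsM : Summable M := h.summable_M a b
  have hsnM : Summable fun j : ℕ => (j : ℝ) * M j := h.mean a b
  have hgeom_le : ∀ s ∈ Set.Ico (0 : ℝ) 1, ∀ n : ℕ, ∑ k ∈ range n, s ^ k ≤ n := fun s hs n => by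
    calc ∑ k ∈ range n, s ^ k ≤ ∑ _k ∈ range n, (1 : ℝ) := sum_le_sum fun k _ => pow_le_one₀ hs.1 hs.2.le
      _ = n := by simp
  have hlim : Tendsto (fun s : ℝ => ∑' n : ℕ, M n * ∑ k ∈ range n, s ^ k) (𝓝[<] 1) (𝓝 (∑' n : ℕ, (n : ℝ) * M n)) :=
    tendsto_tsum_of_dominated_convergence (𝓕 := 𝓝[<] (1 : ℝ))
      (f := fun (s : ℝ) (n : ℕ) => M n * ∑ k ∈ range n, s ^ k) (g := fun n : ℕ => (n : ℝ) * M n)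
      (bound := fun n : ℕ => (n : ℝ) * M n) hsnM
      (fun n => by
        have hc : Continuous fun s : ℝ => M n * ∑ k ∈ range n, s ^ k :=
          continuous_const.mul (continuous_finsetSum _ fun k _ => continuous_pow k)
        have := hc.tendsto 1
        have hval : M n * ∑ k ∈ range n, (1 : ℝ) ^ k = (n : ℝ) * M n := by simp [mul_comm]
        rw [hval] at this
        exact this.mono_left nhdsWithin_le_nhds)
      (by
        filter_upwards [Ico_mem_nhdsLT zero_lt_one] with s hs n
        rw [Real.norm_eq_abs, abs_of_nonneg (mul_nonneg (hM0 n) (sum_nonneg fun k _ => pow_nonneg hs.1 _)), mul_comm]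
        exact mul_le_mul_of_nonneg_right (hgeom_le s hs n) (hM0 n))
  refine hlim.congr' ?_
  filter_upwards [Ico_mem_nhdsLT zero_lt_one] with s hs
  have hs1 : (1 : ℝ) - s ≠ 0 := sub_ne_zero.2 (ne_of_gt hs.2)
  have hMs : Summable fun j : ℕ => M j * s ^ j := h.summable_genM a b hs.1 hs.2.le
  rw [eq_div_iff hs1, ← hsM.tsum_sub hMs, ← tsum_mul_right]
  refine tsum_congr fun n => ?_
  change M n * (∑ k ∈ range n, s ^ k) * (1 - s) = M n - M n * s ^ n
  rw [mul_assoc, geom_sum_mul_neg, mul_sub, mul_one]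

end Kernel

/-! ### §2 The renewal equations of the generating functions on `[0,1)`: `D(s) = I(s) + I(s) D(s)` and `D(s) = I(s) + D(s) I(s)` -/

section GF

/-- Cauchy product with powers for non-negative summable data (plumbing; Mathlib `Summable.tsum_mul_tsum_eq_tsum_sum_antidiagonal`).
[cite: Feller1968, XIII.3; lane plumbing] (Kept `private`: statement-twins are private in `MatrixRenewalCoefficients.lean` and in the strip files.) -/
private theorem tsum_antidiagonal_mul_pow'' {f g : ℕ → ℝ} (hf : ∀ m, 0 ≤ f m) (hg : ∀ m, 0 ≤ g m) {s : ℝ} (hs : 0 ≤ s)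
    (hfs : Summable fun m => f m * s ^ m) (hgs : Summable fun m => g m * s ^ m) :
    (Summable fun m => (∑ p ∈ antidiagonal m, f p.1 * g p.2) * s ^ m) ∧
      ∑' m, (∑ p ∈ antidiagonal m, f p.1 * g p.2) * s ^ m = (∑' m, f m * s ^ m) * ∑' m, g m * s ^ m := by
  have hfg : Summable fun x : ℕ × ℕ => (fun m => f m * s ^ m) x.1 * (fun m => g m * s ^ m) x.2 :=
    hfs.mul_of_nonneg hgs (fun m => mul_nonneg (hf m) (pow_nonneg hs m)) (fun m => mul_nonneg (hg m) (pow_nonneg hs m))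
  have h1 := summable_sum_mul_antidiagonal_of_summable_mul (f := fun m => f m * s ^ m) (g := fun m => g m * s ^ m) hfg
  have h2 := hfs.tsum_mul_tsum_eq_tsum_sum_antidiagonal hgs hfg
  have hterm : ∀ m, ∑ p ∈ antidiagonal m, f p.1 * s ^ p.1 * (g p.2 * s ^ p.2) =
      (∑ p ∈ antidiagonal m, f p.1 * g p.2) * s ^ m := fun m => by
    rw [sum_mul]
    refine sum_congr rfl fun p hp => ?_
    have hp' : p.1 + p.2 = m := HasAntidiagonal.mem_antidiagonal.mp hp
    rw [← hp', pow_add]; ring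
  simp only [hterm] at h1 h2
  exact ⟨h1, h2.symm⟩

/-- ★ **The renewal equation of the generating functions** (left form): for `0 ≤ s < 1` and all `a, b`,
`Σ_m D(m)_{ab} s^m = Σ_j M(j)_{ab} s^j + Σ_c (Σ_j M(j)_{ac} s^j)(Σ_m D(m)_{cb} s^m)` — the Cauchy-product image of `D(m) = M(m) + Σ_{i+j=m} M(i) D(j)`.
[cite: Feller1968, XIII.3 (3.1)–(3.2); Cinlar1969MarkovRenewal, Markov renewal theory, finite state space (locator carried — not held); lane plumbing a-p2 g23] -/
theorem Critical.genD_eq_genM_add_sum (h : K.Critical L) {s : ℝ} (hs0 : 0 ≤ s) (hs1 : s < 1) (a b : ι) :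
    ∑' m : ℕ, K.D m a b * s ^ m =
      (∑' j : ℕ, K.M j a b * s ^ j) + ∑ c, (∑' j : ℕ, K.M j a c * s ^ j) * ∑' m : ℕ, K.D m c b * s ^ m := by
  have hc : ∀ c : ι,
      (∑' j : ℕ, K.M j a c * s ^ j) * (∑' m : ℕ, K.D m c b * s ^ m) =
        ∑' m : ℕ, (∑ p ∈ antidiagonal m, K.M p.1 a c * K.D p.2 c b) * s ^ m ∧
      Summable (fun m : ℕ => (∑ p ∈ antidiagonal m, K.M p.1 a c * K.D p.2 c b) * s ^ m) := fun c => by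
    obtain ⟨h1, h2⟩ := tsum_antidiagonal_mul_pow'' (fun j => K.M_nonneg j a c) (fun m => K.D_nonneg m c b) hs0
      (h.summable_genM a c hs0 hs1.le) (h.summable c b s hs0 hs1)
    exact ⟨h2.symm, h1⟩
  simp_rw [fun c => (hc c).1]
  rw [← Summable.tsum_finsetSum (fun c _ => (hc c).2), ← (h.summable_genM a b hs0 hs1.le).tsum_add
    (summable_sum fun c _ => (hc c).2)]
  refine tsum_congr fun m => ?_
  have hren := congr_fun (congr_fun (K.ren m) a) b
  rw [Matrix.add_apply, Matrix.sum_apply] at hren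
  rw [hren, add_mul]
  congr 1
  simp only [Matrix.mul_apply, sum_mul]
  rw [sum_comm]

/-- ★ **The right-sided renewal equation of the coefficients**: `D(m) = M(m) + Σ_{i+j=m} D(i) M(j)` — peel the LAST piece instead of
the first.  From `1 + D = Σ_k I^k` coefficientwise (the tree's `G_eq_tsum`): `Σ_k I^{k+1} = (Σ_k I^k) · I`.
[cite: Feller1968, XIII.3; Cinlar1969MarkovRenewal, the Markov renewal equations (locator carried — not held); lane plumbing a-p2 g23] -/
theorem ren_right (K : RenewalKernelPair ι) (m : ℕ) : K.D m = K.M m + ∑ p ∈ antidiagonal m, K.D p.1 * K.M p.2 := by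
  ext a b
  rw [Matrix.add_apply, Matrix.sum_apply]
  -- `D(m)_{ab} = G(m)_{ab} − [m=0][a=b] = Σ_k [s^m](I^{k+1})_{ab}`
  have hG := K.G_eq_tsum m a b
  have hsum := K.summable_cf_pow m a b
  have hshift : ∑' k, cf m (K.serM ^ (k + 1)) a b = K.D m a b := by
    have h0 : cf m (K.serM ^ 0) a b = (if m = 0 ∧ a = b then 1 else 0) := by rw [pow_zero, cf_one]
    have := hsum.tsum_eq_zero_add
    rw [← hG, K.G_apply, h0] at this
    linarith
  -- `[s^m](I^{k+1})_{ab} = Σ_{i+j=m} Σ_c [s^i](I^k)_{ac} M(j)_{cb}`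
  have hstep : ∀ k, cf m (K.serM ^ (k + 1)) a b = ∑ p ∈ antidiagonal m, ∑ c, cf p.1 (K.serM ^ k) a c * K.M p.2 c b := fun k => by
    rw [pow_succ, cf_mul]
    simp only [cf_serM]
  rw [← hshift]
  simp_rw [hstep]
  -- swap `Σ'_k` with the finite sums and resum `Σ'_k [s^i](I^k)_{ac} = G(i)_{ac}`
  rw [Summable.tsum_finsetSum (fun p _ => summable_sum fun c _ => (K.summable_cf_pow p.1 a c).mul_right _)]
  have hM : K.M m a b = ∑ p ∈ antidiagonal m, ∑ c, (if p.1 = 0 ∧ a = c then 1 else 0) * K.M p.2 c b := by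
    rw [Finset.sum_eq_single (0, m)]
    · simp
    · intro p hp hne
      have hp' : p.1 + p.2 = m := HasAntidiagonal.mem_antidiagonal.mp hp
      have : p.1 ≠ 0 := fun h0 => hne (by ext <;> simp <;> omega)
      simp [this]
    · intro h; exact absurd (HasAntidiagonal.mem_antidiagonal.mpr (by simp)) h
  rw [hM, ← sum_add_distrib]
  refine sum_congr rfl fun p _ => ?_
  rw [Summable.tsum_finsetSum (fun c _ => (K.summable_cf_pow p.1 a c).mul_right _), Matrix.mul_apply, ← sum_add_distrib]
  refine sum_congr rfl fun c _ => ?_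
  rw [tsum_mul_right, ← K.G_eq_tsum, K.G_apply, add_mul]

/-- ★ **The renewal equation of the generating functions** (right form): for `0 ≤ s < 1`,
`Σ_m D(m)_{ab} s^m = Σ_j M(j)_{ab} s^j + Σ_c (Σ_m D(m)_{ac} s^m)(Σ_j M(j)_{cb} s^j)`.
[cite: Feller1968, XIII.3; Cinlar1969MarkovRenewal, Markov renewal theory, finite state space (locator carried — not held); lane plumbing a-p2 g23] -/
theorem Critical.genD_eq_genM_add_sum' (h : K.Critical L) {s : ℝ} (hs0 : 0 ≤ s) (hs1 : s < 1) (a b : ι) :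
    ∑' m : ℕ, K.D m a b * s ^ m =
      (∑' j : ℕ, K.M j a b * s ^ j) + ∑ c, (∑' m : ℕ, K.D m a c * s ^ m) * ∑' j : ℕ, K.M j c b * s ^ j := by
  have hc : ∀ c : ι,
      (∑' m : ℕ, K.D m a c * s ^ m) * (∑' j : ℕ, K.M j c b * s ^ j) =
        ∑' m : ℕ, (∑ p ∈ antidiagonal m, K.D p.1 a c * K.M p.2 c b) * s ^ m ∧
      Summable (fun m : ℕ => (∑ p ∈ antidiagonal m, K.D p.1 a c * K.M p.2 c b) * s ^ m) := fun c => by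
    obtain ⟨h1, h2⟩ := tsum_antidiagonal_mul_pow'' (fun m => K.D_nonneg m a c) (fun j => K.M_nonneg j c b) hs0
      (h.summable a c s hs0 hs1) (h.summable_genM c b hs0 hs1.le)
    exact ⟨h2.symm, h1⟩
  simp_rw [fun c => (hc c).1]
  rw [← Summable.tsum_finsetSum (fun c _ => (hc c).2), ← (h.summable_genM a b hs0 hs1.le).tsum_add
    (summable_sum fun c _ => (hc c).2)]
  refine tsum_congr fun m => ?_
  have hren := congr_fun (congr_fun (K.ren_right m) a) b
  rw [Matrix.add_apply, Matrix.sum_apply] at hren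
  rw [hren, add_mul]
  congr 1
  simp only [Matrix.mul_apply, sum_mul]
  rw [sum_comm]

end GF

/-! ### §3 Passing to the limit `s ↑ 1`: `M̂ L = L = L M̂` and the normalisation `Σ_{c,d} L_{oc} μ_{cd} L_{db} = L_{ob}` -/

section Limits

/-- `(1 − s) → 0` within `𝓝[<] 1` (plumbing). [folklore] -/
private theorem tendsto_one_sub_nhdsLT : Tendsto (fun s : ℝ => 1 - s) (𝓝[<] 1) (𝓝 0) := by
  have : Tendsto (fun s : ℝ => 1 - s) (𝓝 1) (𝓝 (1 - 1)) := tendsto_const_nhds.sub tendsto_id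
  rw [sub_self] at this
  exact this.mono_left nhdsWithin_le_nhds

/-- ★ **`M̂ L = L`**: `Σ_c (Σ_j M(j)_{ac}) L_{cb} = L_{ab}` — the columns of the Abelian limit are RIGHT fixed vectors of the total-mass matrix
`M̂ = Σ_j M(j)` (multiply the left renewal equation by `1 − s` and let `s ↑ 1`).
[cite: Cinlar1969MarkovRenewal, Markov renewal equations (locator carried — not held); Feller1968, XIII.3; lane «pcv-sawmu» a-p2 g23] -/
theorem Critical.tsum_M_mul_L (h : K.Critical L) (a b : ι) : ∑ c, (∑' j : ℕ, K.M j a c) * L c b = L a b := by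
  have hR : Tendsto (fun s : ℝ => (1 - s) * (∑' j : ℕ, K.M j a b * s ^ j) +
      ∑ c, (∑' j : ℕ, K.M j a c * s ^ j) * ((1 - s) * ∑' m : ℕ, K.D m c b * s ^ m)) (𝓝[<] 1)
      (𝓝 (0 * (∑' j : ℕ, K.M j a b) + ∑ c, (∑' j : ℕ, K.M j a c) * L c b)) :=
    (tendsto_one_sub_nhdsLT.mul (h.tendsto_genM a b)).add (tendsto_finsetSum _ fun c _ => (h.tendsto_genM a c).mul (h.abel c b))
  rw [zero_mul, zero_add] at hR
  refine (tendsto_nhds_unique (hR.congr' ?_) (h.abel a b)).symm ▸ rfl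
  filter_upwards [Ico_mem_nhdsLT zero_lt_one] with s hs
  rw [h.genD_eq_genM_add_sum hs.1 hs.2 a b, mul_add, mul_sum]
  exact congrArg _ (sum_congr rfl fun c _ => by ring)

/-- ★ **`L M̂ = L`**: `Σ_c L_{ac} (Σ_j M(j)_{cb}) = L_{ab}` — the rows of the Abelian limit are LEFT fixed vectors of `M̂` (from the right
renewal equation). [cite: Cinlar1969MarkovRenewal, Markov renewal theory, finite state space (locator carried — not held); Feller1968, XIII.3; lane «pcv-sawmu» a-p2 g23] -/
theorem Critical.L_mul_tsum_M (h : K.Critical L) (a b : ι) : ∑ c, L a c * (∑' j : ℕ, K.M j c b) = L a b := by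
  have hR : Tendsto (fun s : ℝ => (1 - s) * (∑' j : ℕ, K.M j a b * s ^ j) +
      ∑ c, ((1 - s) * ∑' m : ℕ, K.D m a c * s ^ m) * (∑' j : ℕ, K.M j c b * s ^ j)) (𝓝[<] 1)
      (𝓝 (0 * (∑' j : ℕ, K.M j a b) + ∑ c, L a c * (∑' j : ℕ, K.M j c b))) :=
    (tendsto_one_sub_nhdsLT.mul (h.tendsto_genM a b)).add (tendsto_finsetSum _ fun c _ => (h.abel a c).mul (h.tendsto_genM c b))
  rw [zero_mul, zero_add] at hR
  refine (tendsto_nhds_unique (hR.congr' ?_) (h.abel a b)).symm ▸ rfl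
  filter_upwards [Ico_mem_nhdsLT zero_lt_one] with s hs
  rw [h.genD_eq_genM_add_sum' hs.1 hs.2 a b, mul_add, mul_sum]
  exact congrArg _ (sum_congr rfl fun c _ => by ring)

/-- ★★ **The normalisation `Σ_{c,d} L_{oc} μ_{cd} L_{db} = L_{ob}`** with `μ = Σ_j j M(j)` the first-moment matrix: multiply the left renewal
equation on the left by the row `L_{o·}` (a left fixed vector of `M̂`), use `L_{o·}(1 − I(s)) = L_{o·}(M̂ − I(s))`, divide by `1 − s` and let
`s ↑ 1` (the slope `(M̂ − I(s))/(1 − s)` tends to `μ`).  This is the identity that fixes the SCALE of the rank-one limit — the matrix form of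
Feller's `u_n → 1/μ`. [cite: Feller1968, XIII.11; Cinlar1969MarkovRenewal, the Markov renewal theorem: limit = stationary weight / mean (locator carried — not held); lane «pcv-sawmu» a-p2 g23 — own arrangement] -/
theorem Critical.sum_L_mean_L (h : K.Critical L) (o b : ι) :
    ∑ d, (∑ c, L o c * ∑' j : ℕ, (j : ℝ) * K.M j c d) * L d b = L o b := by
  have hℓ : ∀ d, ∑ c, L o c * (∑' j : ℕ, K.M j c d) = L o d := fun d => h.L_mul_tsum_M o d
  have hG : Tendsto (fun s : ℝ => ∑ d, (∑ c, L o c * (((∑' j : ℕ, K.M j c d) - ∑' j : ℕ, K.M j c d * s ^ j) / (1 - s))) *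
      ((1 - s) * ∑' m : ℕ, K.D m d b * s ^ m)) (𝓝[<] 1)
      (𝓝 (∑ d, (∑ c, L o c * ∑' j : ℕ, (j : ℝ) * K.M j c d) * L d b)) :=
    tendsto_finsetSum _ fun d _ => (tendsto_finsetSum _ fun c _ => (h.tendsto_slope_genM c d).const_mul _).mul (h.abel d b)
  have hF : Tendsto (fun s : ℝ => ∑ c, L o c * ∑' j : ℕ, K.M j c b * s ^ j) (𝓝[<] 1) (𝓝 (∑ c, L o c * ∑' j : ℕ, K.M j c b)) :=
    tendsto_finsetSum _ fun c _ => (h.tendsto_genM c b).const_mul _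
  rw [hℓ] at hF
  refine tendsto_nhds_unique (hG.congr' ?_) hF
  filter_upwards [Ico_mem_nhdsLT zero_lt_one] with s hs
  have hne : (1 : ℝ) - s ≠ 0 := sub_ne_zero.2 (ne_of_gt hs.2)
  set I : ι → ι → ℝ := fun c d => ∑' j : ℕ, K.M j c d * s ^ j with hI
  set Ih : ι → ι → ℝ := fun c d => ∑' j : ℕ, K.M j c d with hIh
  set D : ι → ι → ℝ := fun c d => ∑' m : ℕ, K.D m c d * s ^ m with hD
  have hren : ∀ d, D d b = I d b + ∑ e, I d e * D e b := fun d => h.genD_eq_genM_add_sum hs.1 hs.2 d b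
  have hℓ' : ∀ d, ∑ c, L o c * Ih c d = L o d := fun d => hℓ d
  -- remove the `(1 − s)` factors
  have h1 : ∀ d, (∑ c, L o c * ((Ih c d - I c d) / (1 - s))) * ((1 - s) * D d b) = (∑ c, L o c * (Ih c d - I c d)) * D d b := fun d => by
    have hs' : ∑ c, L o c * ((Ih c d - I c d) / (1 - s)) = (∑ c, L o c * (Ih c d - I c d)) * (1 - s)⁻¹ := by
      simp only [div_eq_mul_inv, sum_mul]
      exact sum_congr rfl fun c _ => by ring
    rw [hs', mul_assoc, ← mul_assoc (1 - s)⁻¹, inv_mul_cancel₀ hne, one_mul]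
  change ∑ d, (∑ c, L o c * ((Ih c d - I c d) / (1 - s))) * ((1 - s) * D d b) = ∑ c, L o c * I c b
  simp_rw [h1, mul_sub, sum_sub_distrib, hℓ', sub_mul, sum_sub_distrib]
  have h2 : ∑ d, L o d * D d b = ∑ c, L o c * I c b + ∑ d, (∑ c, L o c * I c d) * D d b := by
    calc ∑ d, L o d * D d b = ∑ d, (L o d * I d b + ∑ e, L o d * (I d e * D e b)) := by
          refine sum_congr rfl fun d _ => ?_
          rw [hren d, mul_add, mul_sum]
      _ = ∑ c, L o c * I c b + ∑ d, ∑ e, L o d * (I d e * D e b) := sum_add_distrib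
      _ = ∑ c, L o c * I c b + ∑ e, ∑ d, L o d * (I d e * D e b) := by rw [sum_comm]
      _ = ∑ c, L o c * I c b + ∑ d, (∑ c, L o c * I c d) * D d b := by
          congr 1
          refine sum_congr rfl fun e _ => ?_
          rw [sum_mul]
          exact sum_congr rfl fun d _ => by ring
  linarith

end Limits

/-! ### §4 Rank one: the total-mass matrix is irreducible, so all columns (rows) of `L` are proportional -/

section RankOne

/-- The coefficients of the powers of the one-piece series lie below the powers of the total-mass matrix:
`[s^m](I^k)_{ab} ≤ (M̂^k)_{ab}`, `M̂ = Σ_j M(j)` (plumbing). [cite: Feller1968, XIII.3; lane plumbing a-p2 g23] -/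
theorem Critical.cf_pow_le_pow_tsum (h : K.Critical L) (k m : ℕ) (a b : ι) :
    cf m (K.serM ^ k) a b ≤ ((Matrix.of fun a b : ι => ∑' j : ℕ, K.M j a b) ^ k) a b := by
  induction k generalizing m a b with
  | zero =>
    rw [pow_zero, pow_zero, cf_one, Matrix.one_apply]
    by_cases hab : a = b
    · by_cases hm : m = 0
      · simp [hab, hm]
      · simp [hab, hm]
    · simp [hab]
  | succ k ih =>
    rw [pow_succ, pow_succ, cf_mul, Matrix.mul_apply]
    have hpow0 : ∀ a c, 0 ≤ ((Matrix.of fun a b : ι => ∑' j : ℕ, K.M j a b) ^ k) a c := fun a c =>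
      (K.coeffNonneg_serM.pow k 0 a c).trans (ih 0 a c)
    calc ∑ p ∈ antidiagonal m, ∑ c, cf p.1 (K.serM ^ k) a c * cf p.2 K.serM c b
        = ∑ c, ∑ p ∈ antidiagonal m, cf p.1 (K.serM ^ k) a c * K.M p.2 c b := by
          rw [sum_comm]; simp only [cf_serM]
      _ ≤ ∑ c, ∑ p ∈ antidiagonal m, ((Matrix.of fun a b : ι => ∑' j : ℕ, K.M j a b) ^ k) a c * K.M p.2 c b :=
          sum_le_sum fun c _ => sum_le_sum fun p _ => mul_le_mul_of_nonneg_right (ih _ _ _) (K.M_nonneg _ _ _)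
      _ = ∑ c, ((Matrix.of fun a b : ι => ∑' j : ℕ, K.M j a b) ^ k) a c * ∑ p ∈ antidiagonal m, K.M p.2 c b := by
          simp only [mul_sum]
      _ ≤ ∑ c, ((Matrix.of fun a b : ι => ∑' j : ℕ, K.M j a b) ^ k) a c * (Matrix.of fun a b : ι => ∑' j : ℕ, K.M j a b) c b := by
          refine sum_le_sum fun c _ => mul_le_mul_of_nonneg_left ?_ (hpow0 a c)
          rw [Matrix.of_apply]
          calc ∑ p ∈ antidiagonal m, K.M p.2 c b = ∑ j ∈ (antidiagonal m).image Prod.snd, K.M j c b := by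
                rw [sum_image]
                intro p hp q hq hpq
                have hp' := HasAntidiagonal.mem_antidiagonal.mp hp
                have hq' := HasAntidiagonal.mem_antidiagonal.mp hq
                ext <;> omega
            _ ≤ ∑' j : ℕ, K.M j c b := (h.summable_M c b).sum_le_tsum _ fun j _ => K.M_nonneg j c b

/-- ★ **The total-mass matrix `M̂ = Σ_j M(j)` is entrywise non-negative and irreducible** under criticality (irreducibility is inherited
from `L > 0` through the positivity semigroup of the tree, `Critical.exists_pos`). [cite: Seneta1973, §1.1; Feller1968, XIII.3–4; lane «pcv-sawmu» a-p2 g23] -/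
theorem Critical.tsum_M_nonneg_irred (h : K.Critical L) :
    (∀ a b : ι, 0 ≤ (Matrix.of fun a b : ι => ∑' j : ℕ, K.M j a b) a b) ∧
      ∀ a b : ι, ∃ k : ℕ, 0 < ((Matrix.of fun a b : ι => ∑' j : ℕ, K.M j a b) ^ k) a b := by
  refine ⟨fun a b => by rw [Matrix.of_apply]; exact tsum_nonneg fun j => K.M_nonneg j a b, fun a b => ?_⟩
  obtain ⟨m, k, hk⟩ := h.exists_pos a b
  exact ⟨k, hk.trans_le (h.cf_pow_le_pow_tsum k m a b)⟩

/-- ★★ **The Abelian limit has rank one**: `L_{ab} L_{cd} = L_{ad} L_{cb}` for all levels.  Every column of `L` is a positive right fixed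
vector of the irreducible `M̂ ≥ 0` (§3), and such a vector is unique up to a factor (the tree's minimum-ratio lemma
`Literature.Analysis.Matrix.exists_eq_smul_of_mulVec_eq` — no Perron–Frobenius). [cite: Seneta1973, §1.4 (uniqueness of the positive eigenvector); Cinlar1969MarkovRenewal, Markov renewal theory, finite state space (locator carried — not held); lane «pcv-sawmu» a-p2 g23] -/
theorem Critical.L_mul_L_eq (h : K.Critical L) (a b c d : ι) : L a b * L c d = L a d * L c b := by
  haveI : Nonempty ι := ⟨a⟩
  obtain ⟨hnn, hirr⟩ := h.tsum_M_nonneg_irred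
  have hcol : ∀ e : ι, (Matrix.of fun a b : ι => ∑' j : ℕ, K.M j a b) *ᵥ (fun x => L x e) = fun x => L x e := fun e => by
    funext x
    simp only [Matrix.mulVec, dotProduct, Matrix.of_apply]
    exact h.tsum_M_mul_L x e
  obtain ⟨t, ht⟩ := exists_eq_smul_of_mulVec_eq hnn hirr (fun x => h.pos x d) (hcol d) (hcol b)
  have htx : ∀ x, L x b = t * L x d := fun x => by have := congr_fun ht x; simpa using this
  rw [htx a, htx c]; ring

end RankOne

/-! ### §5 ★★★ THE CONSTANT OF THE MATRIX RENEWAL THEOREM -/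

section Constant

/-- ★★★ **THE CONSTANT OF THE MATRIX RENEWAL THEOREM** (fixed-vector-free form).  For a critical matrix renewal pair (`K.Critical L`:
`D(m) = M(m) + Σ_{i+j=m} M(i)D(j)`, Abelian limits `(1 − s)Σ_m D(m)_{ab}s^m → L_{ab} > 0`, finite first moment `μ = Σ_j j M(j)`), for EVERY
reference level `o` and all `a, b`:
`L_{ab} · (Σ_{c,d} L_{oc} μ_{cd} L_{do}) = L_{ao} · L_{ob}`,
i.e. `L = u ℓᵀ/(ℓ · μ u)` with `u = L_{·o}` (a right fixed vector of `M̂ = Σ_j M(j)`) and `ℓ = L_{o·}` (a left fixed vector).  Together with the tree's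
pointwise theorem `RenewalKernelPair.tendsto_coeff` (`D(m)_{ab} → L_{ab}`) this is the Markov renewal theorem with its constant IDENTIFIED:
(entrance weight) × (exit weight) / (mean piece length under the invariant weighting) — the matrix form of Feller's `u_n → 1/μ`
(the tree's `Critical.eq_inv_tsum_mul_phi` gives the diagonal through first-RETURN lengths; here through the one-piece kernel directly).
No spectral theory: renewal equations on both sides, the endpoint slope, and the minimum-ratio uniqueness of positive fixed vectors.
[cite: Cinlar1969MarkovRenewal, Markov renewal theorem, finite state space (locator carried — not held); Feller1968, XIII.11; Seneta1973, §6.2 Theorems 6.3–6.4 and §1.4; lane «pcv-sawmu» a-p2 g23 — own arrangement] -/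
theorem Critical.L_mul_sum_mean_eq (h : K.Critical L) (o a b : ι) :
    L a b * ∑ d, (∑ c, L o c * ∑' j : ℕ, (j : ℝ) * K.M j c d) * L d o = L a o * L o b := by
  rw [h.sum_L_mean_L o o, h.L_mul_L_eq a b o o]

/-- ★★★ **THE CONSTANT OF THE MATRIX RENEWAL THEOREM** (fixed-vector form).  For ANY right fixed vector `u` (`M̂ u = u`) and ANY left fixed
vector `ℓ` (`ℓ M̂ = ℓ`) of the total-mass matrix `M̂ = Σ_j M(j)` — of any sign — and all `a, b`:
`L_{ab} · ⟨ℓ, μ u⟩ = u_a ℓ_b`, `μ = Σ_j j M(j)`.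
With positive `u`, `ℓ` (they exist: columns and rows of `L`) this reads `L_{ab} = u_a ℓ_b/⟨ℓ, μ u⟩` and `⟨ℓ, μ u⟩ > 0`.
[cite: Cinlar1969MarkovRenewal, Markov renewal theory, finite state space (locator carried — not held); Feller1968, XIII.11; Seneta1973, §6.2 and §1.4; lane «pcv-sawmu» a-p2 g23 — own arrangement] -/
theorem Critical.L_mul_dotProduct_mean_eq (h : K.Critical L) {u ℓ : ι → ℝ}
    (hu : (Matrix.of fun a b : ι => ∑' j : ℕ, K.M j a b) *ᵥ u = u) (hℓ : ℓ ᵥ* (Matrix.of fun a b : ι => ∑' j : ℕ, K.M j a b) = ℓ)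
    (a b : ι) :
    L a b * (ℓ ⬝ᵥ ((Matrix.of fun c d : ι => ∑' j : ℕ, (j : ℝ) * K.M j c d) *ᵥ u)) = u a * ℓ b := by
  haveI : Nonempty ι := ⟨a⟩
  obtain ⟨hnn, hirr⟩ := h.tsum_M_nonneg_irred
  -- reference level `o := a`; the column / row of `L` through `o` are positive fixed vectors
  set o := a
  have hcol : (Matrix.of fun a b : ι => ∑' j : ℕ, K.M j a b) *ᵥ (fun x => L x o) = fun x => L x o := by
    funext x; simp only [Matrix.mulVec, dotProduct, Matrix.of_apply]; exact h.tsum_M_mul_L x o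
  have hrow : (fun y => L o y) ᵥ* (Matrix.of fun a b : ι => ∑' j : ℕ, K.M j a b) = fun y => L o y := by
    funext y; simp only [Matrix.vecMul, dotProduct, Matrix.of_apply]; exact h.L_mul_tsum_M o y
  obtain ⟨α, hα⟩ := exists_eq_smul_of_mulVec_eq hnn hirr (fun x => h.pos x o) hcol hu
  obtain ⟨β, hβ⟩ := exists_eq_smul_of_vecMul_eq hnn hirr (fun y => h.pos o y) hrow hℓ
  have hux : ∀ x, u x = α * L x o := fun x => by have := congr_fun hα x; simpa using this
  have hℓy : ∀ y, ℓ y = β * L o y := fun y => by have := congr_fun hβ y; simpa using this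
  have hdot : ℓ ⬝ᵥ ((Matrix.of fun c d : ι => ∑' j : ℕ, (j : ℝ) * K.M j c d) *ᵥ u) =
      α * β * ∑ d, (∑ c, L o c * ∑' j : ℕ, (j : ℝ) * K.M j c d) * L d o := by
    simp only [Matrix.mulVec, dotProduct, Matrix.of_apply, hux, hℓy, mul_sum, sum_mul]
    rw [sum_comm]
    exact sum_congr rfl fun d _ => sum_congr rfl fun c _ => by ring
  rw [hdot, hux a, hℓy b]
  have key := h.L_mul_sum_mean_eq o a b
  calc L a b * (α * β * ∑ d, (∑ c, L o c * ∑' j : ℕ, (j : ℝ) * K.M j c d) * L d o)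
      = α * β * (L a b * ∑ d, (∑ c, L o c * ∑' j : ℕ, (j : ℝ) * K.M j c d) * L d o) := by ring
    _ = α * β * (L a o * L o b) := by rw [key]
    _ = α * L a o * (β * L o b) := by ring

/-- ★★ **Positive fixed vectors exist and the mean pairing is positive**: the column `L_{·o}` and the row `L_{o·}` are positive right / left
fixed vectors of `M̂`, and `Σ_{c,d} L_{oc} μ_{cd} L_{do} = L_{oo} > 0`. [cite: Cinlar1969MarkovRenewal, Markov renewal theory, finite state space (locator carried — not held); Seneta1973, §6.2; lane «pcv-sawmu» a-p2 g23] -/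
theorem Critical.exists_pos_fixed (h : K.Critical L) (o : ι) :
    ((Matrix.of fun a b : ι => ∑' j : ℕ, K.M j a b) *ᵥ (fun x => L x o) = fun x => L x o) ∧
      ((fun y => L o y) ᵥ* (Matrix.of fun a b : ι => ∑' j : ℕ, K.M j a b) = fun y => L o y) ∧
      (∀ x, 0 < L x o) ∧ (∀ y, 0 < L o y) ∧
      ∑ d, (∑ c, L o c * ∑' j : ℕ, (j : ℝ) * K.M j c d) * L d o = L o o ∧ 0 < L o o := by
  refine ⟨?_, ?_, fun x => h.pos x o, fun y => h.pos o y, h.sum_L_mean_L o o, h.pos o o⟩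
  · funext x; simp only [Matrix.mulVec, dotProduct, Matrix.of_apply]; exact h.tsum_M_mul_L x o
  · funext y; simp only [Matrix.vecMul, dotProduct, Matrix.of_apply]; exact h.L_mul_tsum_M o y

/-- ★★★ **POINTWISE, WITH THE CONSTANT**: under `K.Critical L`, for every reference level `o` and all `a, b`,
`D(m)_{ab} ⟶ L_{ao} L_{ob} / L_{oo}` and `L_{oo} = (Σ_{c,d} L_{oc} μ_{cd} L_{do})`… i.e. the tree's `tendsto_coeff` with the limit written as
(entrance weight `L_{ao}`) × (exit weight `L_{ob}`) / (normalising mean `Σ_{c,d} L_{oc} μ_{cd} L_{do}`).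
[cite: Cinlar1969MarkovRenewal, Markov renewal theory, finite state space (locator carried — not held); Feller1968, XIII.3, XIII.11; lane «pcv-sawmu» a-p2 g23] -/
theorem Critical.tendsto_coeff_const (h : K.Critical L) (o a b : ι) :
    Tendsto (fun m => K.D m a b) atTop
      (𝓝 (L a o * L o b / ∑ d, (∑ c, L o c * ∑' j : ℕ, (j : ℝ) * K.M j c d) * L d o)) := by
  have h1 := K.tendsto_coeff h a b
  have hmean : ∑ d, (∑ c, L o c * ∑' j : ℕ, (j : ℝ) * K.M j c d) * L d o = L o o := h.sum_L_mean_L o o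
  rw [hmean, ← h.L_mul_L_eq a b o o, mul_div_assoc, div_self (h.pos o o).ne', mul_one]
  exact h1

end Constant





end RenewalKernelPair

end Literature.Probability.Process
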